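import Mathlib
import Literature.Analysis.FluidPDE.AncientMildCompactness
import Literature.Analysis.FluidPDE.NSVorticityBKMProofs
import Literature.Analysis.FluidPDE.VorticityCalculus
import Summits.NavierStokesRegularity.NavierStokesRegularity.Theorems.SlicedKelvinFluxZoomStubOseenBoxRegularity
import Summits.NavierStokesRegularity.NavierStokesRegularity.Theorems.SlicedKelvinFluxZoomStubOseenWindowShift
import Summits.NavierStokesRegularity.NavierStokesRegularity.Theorems.SlicedKelvinFluxZoomStubFderivLimit
import Summits.NavierStokesRegularity.NavierStokesRegularity.Theorems.SlicedKelvinFluxZoomStubSliceFDerivContinuous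
import Summits.NavierStokesRegularity.NavierStokesRegularity.Theses.SlicedKelvin

/-!
# Crux `FluxZoom` (stmt-NavierStokesRegularity-15603), line `registered`: the limit of the
# vorticity-clock zoom (helper file 2 for the lead's stub `stub_zoomCoreUnit`)

Passage to the limit in the zoom sequence `v_j → W` of KNSS 2009, Lemma 6.1 (`KNSS2009_lemma61_oseenMild`)
for quantities one derivative up: the limit field `W` (bounded, continuous, weakly divergence free,
Oseen-mild on `(−∞, 0)`) is jointly smooth (`zoomLimit_contDiffOn`, window regularity); the vorticity of
the `v_j` converges pointwise to the vorticity of `W` (`zoomLimit_curl_tendsto`: uniform `C²` bounds on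
windows + `stub_fderivLimit`); the unsigned planar flux bound passes to the limit by Fatou
(`zoomLimit_flux_le`); and a record `|curl v_j(0,0)| = 1` at the final time forces
`|curl W(s₀, 0)| ≥ 3/4` at a fixed negative time `s₀` (`zoomLimit_curl_ne_zero`: uniform time-Lipschitz
bound of `∇v_j` on `(−1/2, 0)` and continuity of `∇v_j(·)(0)` at the final time).
-/

noncomputable section

open Set MeasureTheory Filter Topology Function

-- the summit and its single sub-problem share the name (CONVENTIONS §1), as in every Theorems file
set_option linter.dupNamespace false

namespace Summit.NavierStokesRegularity.NavierStokesRegularity.Theorems.FluxZoom.Registered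

open Literature.Analysis.FluidPDE

/-- **Window regularity, closed form** (`stub_oseenWindowShift stub_oseenBoxRegularity`): bounded continuous
Oseen-mild fields on a window `(a, b)` are jointly smooth with derivative and time-Lipschitz bounds on
`(a + δ, b)` uniform in the field. -/
theorem windowRegularity_closed :
    ∀ (N a b : ℝ), a < b → ∃ (C L : ℕ → ℝ → ℝ),
      ∀ (V : ℝ → EuclideanSpace ℝ (Fin 3) → EuclideanSpace ℝ (Fin 3)),
        ContinuousOn (Function.uncurry V) (Set.Ioo a b ×ˢ Set.univ) →
        (∀ t ∈ Set.Ioo a b, Literature.Analysis.FluidPDE.IsWeaklyDivFree (V t)) →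
        (∀ t ∈ Set.Ioo a b, ∀ x, ‖V t x‖ ≤ N) →
        (∀ s t : ℝ, a < s → s < t → t < b → ∀ x,
          V t x = Literature.Analysis.UnboundedOperators.heatExtension (V s) (t - s) x -
            Literature.Analysis.FluidPDE.oseenDuhamel 1 s V V t x) →
        ContDiffOn ℝ (⊤ : ℕ∞) (Function.uncurry V) (Set.Ioo a b ×ˢ Set.univ) ∧
        (∀ t ∈ Set.Ioo a b, Literature.Analysis.FluidPDE.VectorCalculus.IsDivFree (V t)) ∧
        (∀ δ : ℝ, 0 < δ → ∀ k : ℕ, ∀ t ∈ Set.Ioo (a + δ) b, ∀ x,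
          ‖iteratedFDeriv ℝ k (V t) x‖ ≤ C k δ) ∧
        (∀ δ : ℝ, 0 < δ → ∀ k : ℕ, ∀ s ∈ Set.Ioo (a + δ) b, ∀ t ∈ Set.Ioo (a + δ) b, ∀ x,
          ‖iteratedFDeriv ℝ k (V t) x - iteratedFDeriv ℝ k (V s) x‖ ≤ L k δ * |t - s|) :=
  stub_oseenWindowShift stub_oseenBoxRegularity

section Limit

variable {W : ℝ → EuclideanSpace ℝ (Fin 3) → EuclideanSpace ℝ (Fin 3)} {N : ℝ}

/-- A slice of a field that is jointly `C^n` on an open time slab is `C^n`. -/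
theorem contDiff_slice_of_contDiffOn {n : WithTop ℕ∞} {S : Set ℝ}
    {V : ℝ → EuclideanSpace ℝ (Fin 3) → EuclideanSpace ℝ (Fin 3)}
    (h : ContDiffOn ℝ n (uncurry V) (S ×ˢ univ)) {t : ℝ} (ht : t ∈ S) : ContDiff ℝ n (V t) := by
  have e : V t = uncurry V ∘ fun y => (t, y) := rfl
  rw [e, ← contDiffOn_univ]
  exact h.comp (contDiff_prodMk_right t).contDiffOn fun y _ => ⟨ht, mem_univ y⟩

/-- **The limit of the zoom is jointly smooth on `(−∞, 0) × ℝ³`**: an ancient bounded continuous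
Oseen-mild field is smooth on every window `(−m−1, 0)` (window regularity), and smoothness is local. -/
theorem zoomLimit_contDiffOn (hWc : ContinuousOn (uncurry W) (Iio 0 ×ˢ univ))
    (hWdiv : ∀ t < 0, IsWeaklyDivFree (W t)) (hWbd : ∀ t < 0, ∀ x, ‖W t x‖ ≤ N)
    (hWmild : ∀ s t : ℝ, s < t → t < 0 → ∀ x,
      W t x = Literature.Analysis.UnboundedOperators.heatExtension (W s) (t - s) x -
        oseenDuhamel 1 s W W t x) :
    ContDiffOn ℝ (⊤ : ℕ∞) (uncurry W) (Iio 0 ×ˢ univ) := by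
  -- smoothness on each window `(a, 0)`, `a < 0`
  have hwin : ∀ a < (0 : ℝ), ContDiffOn ℝ (⊤ : ℕ∞) (uncurry W) (Ioo a 0 ×ˢ univ) := by
    intro a ha
    obtain ⟨C, L, hCL⟩ := windowRegularity_closed N a 0 ha
    exact (hCL W (hWc.mono (prod_mono (fun t ht => ht.2) Subset.rfl)) (fun t ht => hWdiv t ht.2)
      (fun t ht x => hWbd t ht.2 x) (fun s t _ hst ht x => hWmild s t hst ht x)).1
  intro z hz
  obtain ⟨hz1, -⟩ := mem_prod.1 hz
  have hz1' : z.1 < 0 := hz1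
  have hopen : IsOpen (Ioo (z.1 - 1) 0 ×ˢ (univ : Set (EuclideanSpace ℝ (Fin 3)))) :=
    isOpen_Ioo.prod isOpen_univ
  have hmem : z ∈ Ioo (z.1 - 1) 0 ×ˢ (univ : Set (EuclideanSpace ℝ (Fin 3))) :=
    ⟨⟨by linarith, hz1'⟩, mem_univ _⟩
  exact ((hwin (z.1 - 1) (by linarith)).contDiffAt (hopen.mem_nhds hmem)).contDiffWithinAt

end Limit


section Sequence

variable {W : ℝ → EuclideanSpace ℝ (Fin 3) → EuclideanSpace ℝ (Fin 3)} {N : ℝ}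
  {A B : ℕ → ℝ} {V : ℕ → ℝ → EuclideanSpace ℝ (Fin 3) → EuclideanSpace ℝ (Fin 3)}

/-- **The vorticity converges pointwise along the zoom**: if the fields `V j` (jointly smooth on
`(A j, B j) × ℝ³`, `A j → −∞`, `B j > 0`, weakly divergence free, bounded by `N` on `(A j, 0]`, Oseen-mild
before the final time) converge slice-wise locally uniformly on `(−∞, 0)` to the bounded continuous
Oseen-mild field `W`, then `curl (V j t) x → curl (W t) x` for every `t < 0` and `x` (uniform `C²` bounds
on the window `(t − 1, 0)` from the window regularity, then `stub_fderivLimit`; `curl = curlCLM ∘ D`). -/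
theorem zoomLimit_curl_tendsto (hA : Tendsto A atTop atBot) (hB : ∀ j, 0 < B j)
    (hVsm : ∀ j, ContDiffOn ℝ (⊤ : ℕ∞) (uncurry (V j)) (Ioo (A j) (B j) ×ˢ univ))
    (hVdiv : ∀ j, ∀ t ∈ Ioo (A j) (B j), IsWeaklyDivFree (V j t))
    (hVbd : ∀ j, ∀ t ∈ Ioc (A j) 0, ∀ x, ‖V j t x‖ ≤ N)
    (hVmild : ∀ j, ∀ s t : ℝ, A j < s → s < t → t < 0 → ∀ x,
      V j t x = Literature.Analysis.UnboundedOperators.heatExtension (V j s) (t - s) x -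
        oseenDuhamel 1 s (V j) (V j) t x)
    (hWc : ContinuousOn (uncurry W) (Iio 0 ×ˢ univ))
    (hWdiv : ∀ t < 0, IsWeaklyDivFree (W t)) (hWbd : ∀ t < 0, ∀ x, ‖W t x‖ ≤ N)
    (hWmild : ∀ s t : ℝ, s < t → t < 0 → ∀ x,
      W t x = Literature.Analysis.UnboundedOperators.heatExtension (W s) (t - s) x -
        oseenDuhamel 1 s W W t x)
    (hloc : ∀ t < 0, TendstoLocallyUniformly (fun j => V j t) (W t) atTop) :
    ∀ t < 0, ∀ x, Tendsto (fun j => curl (V j t) x) atTop (𝓝 (curl (W t) x)) := by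
  intro t ht x
  obtain ⟨C, L, hCL⟩ := windowRegularity_closed N (t - 1) 0 (by linarith)
  -- the limit on the window `(t − 1, 0)`
  have hW := hCL W (hWc.mono (prod_mono (fun s hs => hs.2) Subset.rfl)) (fun s hs => hWdiv s hs.2)
    (fun s hs y => hWbd s hs.2 y) (fun s s' _ hss' hs' y => hWmild s s' hss' hs' y)
  have htI : t ∈ Ioo (t - 1 + 1 / 2) 0 := ⟨by linarith, ht⟩
  have hWt : ContDiff ℝ 2 (W t) :=
    (contDiff_slice_of_contDiffOn hW.1 (show t ∈ Ioo (t - 1) 0 from ⟨by linarith, ht⟩)).of_le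
      (by norm_cast)
  have hWb : ∀ y, ‖iteratedFDeriv ℝ 2 (W t) y‖ ≤ C 2 (1 / 2) := fun y =>
    hW.2.2.1 (1 / 2) (by norm_num) 2 t htI y
  -- the fields on the window, eventually
  have hev : ∀ᶠ j in atTop, A j < t - 1 := hA.eventually (eventually_lt_atBot _)
  have hfj : ∀ᶠ j in atTop, ContDiff ℝ 2 (V j t) ∧ ∀ y, ‖iteratedFDeriv ℝ 2 (V j t) y‖ ≤ C 2 (1 / 2) := by
    filter_upwards [hev] with j hj
    have hsub1 : Ioo (t - 1) 0 ⊆ Ioo (A j) (B j) := fun s hs => ⟨hj.trans hs.1, hs.2.trans (hB j)⟩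
    have hVj := hCL (V j) ((hVsm j).continuousOn.mono (prod_mono hsub1 Subset.rfl))
      (fun s hs => hVdiv j s (hsub1 hs)) (fun s hs y => hVbd j s ⟨hj.trans hs.1, hs.2.le⟩ y)
      (fun s s' hs hss' hs' y => hVmild j s s' (hj.trans hs) hss' hs' y)
    refine ⟨(contDiff_slice_of_contDiffOn (hVsm j)
      (show t ∈ Ioo (A j) (B j) from ⟨hj.trans (by linarith), ht.trans (hB j)⟩)).of_le (by norm_cast),
      fun y => hVj.2.2.1 (1 / 2) (by norm_num) 2 t htI y⟩
  have hD := stub_fderivLimit (C 2 (1 / 2)) (fun j => V j t) (W t) x hfj hWt hWb (hloc t ht)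
  have e : ∀ f : EuclideanSpace ℝ (Fin 3) → EuclideanSpace ℝ (Fin 3),
      curl f x = curlCLM (fderiv ℝ f x) := fun f => rfl
  simp only [e]
  exact (curlCLM.continuous.tendsto _).comp hD

/-- The plane parametrisation `y ↦ R (y₀, y₁, c)` is continuous. -/
theorem continuous_planeMap (R : EuclideanSpace ℝ (Fin 3) ≃ₗᵢ[ℝ] EuclideanSpace ℝ (Fin 3)) (c : ℝ) :
    Continuous fun y : EuclideanSpace ℝ (Fin 2) =>
      R (WithLp.toLp 2 ![y 0, y 1, c] : EuclideanSpace ℝ (Fin 3)) := by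
  refine R.continuous.comp ?_
  fun_prop

/-- **The planar flux bound passes to the limit** (Fatou on every plane): if the unsigned flux of
`curl (V j t)` through every plane is `≤ Φ` for `t ∈ (A j, 0]` and the vorticity converges pointwise, the
unsigned flux of `curl (W t)` through every plane is `≤ Φ` for every `t < 0`. -/
theorem zoomLimit_flux_le (hA : Tendsto A atTop atBot) (hB : ∀ j, 0 < B j)
    (hVsm : ∀ j, ContDiffOn ℝ (⊤ : ℕ∞) (uncurry (V j)) (Ioo (A j) (B j) ×ˢ univ)) {Φ : ℝ}
    (hVflux : ∀ j, ∀ t ∈ Ioc (A j) 0,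
      ∀ (R : EuclideanSpace ℝ (Fin 3) ≃ₗᵢ[ℝ] EuclideanSpace ℝ (Fin 3)) (c' : ℝ),
        ∫⁻ y : EuclideanSpace ℝ (Fin 2),
          ‖inner ℝ (curl (V j t) (R (WithLp.toLp 2 ![y 0, y 1, c']))) (R (EuclideanSpace.single 2 1))‖ₑ ≤
            ENNReal.ofReal Φ)
    (hcurl : ∀ t < 0, ∀ x, Tendsto (fun j => curl (V j t) x) atTop (𝓝 (curl (W t) x))) :
    ∀ t < 0, ∀ (R : EuclideanSpace ℝ (Fin 3) ≃ₗᵢ[ℝ] EuclideanSpace ℝ (Fin 3)) (c' : ℝ),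
      ∫⁻ y : EuclideanSpace ℝ (Fin 2),
        ‖inner ℝ (curl (W t) (R (WithLp.toLp 2 ![y 0, y 1, c']))) (R (EuclideanSpace.single 2 1))‖ₑ ≤
          ENNReal.ofReal Φ := by
  intro t ht R c'
  obtain ⟨j₀, hj₀⟩ := eventually_atTop.1 (hA.eventually (eventually_lt_atBot t))
  set P : EuclideanSpace ℝ (Fin 2) → EuclideanSpace ℝ (Fin 3) :=
    fun y => R (WithLp.toLp 2 ![y 0, y 1, c']) with hP
  have hPc : Continuous P := continuous_planeMap R c'
  set F : ℕ → EuclideanSpace ℝ (Fin 2) → ENNReal :=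
    fun j y => ‖inner ℝ (curl (V (j + j₀) t) (P y)) (R (EuclideanSpace.single 2 1))‖ₑ with hF
  -- measurability of the integrands (the slices are smooth)
  have hmeas : ∀ j, Measurable (F j) := by
    intro j
    have htj : t ∈ Ioo (A (j + j₀)) (B (j + j₀)) := ⟨hj₀ _ (Nat.le_add_left _ _), ht.trans (hB _)⟩
    have hc1 : ContDiff ℝ 1 (V (j + j₀) t) :=
      (contDiff_slice_of_contDiffOn (hVsm _) htj).of_le (by norm_cast)
    exact (((continuous_curl hc1).comp hPc).inner continuous_const).measurable.enorm
  -- pointwise convergence of the integrands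
  have hlim : ∀ y, Tendsto (fun j => F j y) atTop
      (𝓝 ‖inner ℝ (curl (W t) (P y)) (R (EuclideanSpace.single 2 1))‖ₑ) := fun y =>
    (continuous_enorm.tendsto _).comp
      (((hcurl t ht (P y)).comp (tendsto_add_atTop_nat j₀)).inner tendsto_const_nhds)
  calc ∫⁻ y, ‖inner ℝ (curl (W t) (P y)) (R (EuclideanSpace.single 2 1))‖ₑ
      = ∫⁻ y, liminf (fun j => F j y) atTop := lintegral_congr fun y => ((hlim y).liminf_eq).symm
    _ ≤ liminf (fun j => ∫⁻ y, F j y) atTop := lintegral_liminf_le' fun j => (hmeas j).aemeasurable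
    _ ≤ ENNReal.ofReal Φ := by
        refine liminf_le_of_frequently_le' (Eventually.of_forall fun j => ?_).frequently
        exact hVflux (j + j₀) t ⟨hj₀ _ (Nat.le_add_left _ _), ht.le⟩ R c'

/-- **A record at the final time survives at a fixed negative time in the limit.** If moreover
`|curl (V j 0) 0| = 1` for all `j`, then `curl (W s₀) 0 ≠ 0` for `s₀ = −1/(16(L₁+1))`, `L₁` the uniform
time-Lipschitz constant of `∇V j` on `(−1/2, 0)` (window regularity on `(−1, 0)`): for `s₀ < t' < 0`,
`‖∇V j(t') 0 − ∇V j(s₀) 0‖ ≤ L₁|s₀| ≤ 1/16`, which passes to `t' = 0` by continuity of `∇V j(·)(0)`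
(`stub_sliceFDerivContinuous`), so `‖curl V j(s₀) 0‖ ≥ 1 − 4/16 = 3/4`, and `curl V j(s₀) 0 → curl W(s₀) 0`. -/
theorem zoomLimit_curl_ne_zero (hA : Tendsto A atTop atBot) (hB : ∀ j, 0 < B j)
    (hVsm : ∀ j, ContDiffOn ℝ (⊤ : ℕ∞) (uncurry (V j)) (Ioo (A j) (B j) ×ˢ univ))
    (hVdiv : ∀ j, ∀ t ∈ Ioo (A j) (B j), IsWeaklyDivFree (V j t))
    (hVbd : ∀ j, ∀ t ∈ Ioc (A j) 0, ∀ x, ‖V j t x‖ ≤ N)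
    (hVmild : ∀ j, ∀ s t : ℝ, A j < s → s < t → t < 0 → ∀ x,
      V j t x = Literature.Analysis.UnboundedOperators.heatExtension (V j s) (t - s) x -
        oseenDuhamel 1 s (V j) (V j) t x)
    (hone : ∀ j, ‖curl (V j 0) 0‖ = 1)
    (hcurl : ∀ t < 0, ∀ x, Tendsto (fun j => curl (V j t) x) atTop (𝓝 (curl (W t) x))) :
    ∃ t < 0, ∃ x, curl (W t) x ≠ 0 := by
  obtain ⟨C, L, hCL⟩ := windowRegularity_closed N (-1) 0 (by norm_num)
  set L₁ : ℝ := max (L 1 (1 / 2)) 0 with hL₁def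
  have hL₁ : 0 ≤ L₁ := le_max_right _ _
  set s₀ : ℝ := -(1 / (16 * (L₁ + 1))) with hs₀def
  have hfrac : 0 < 1 / (16 * (L₁ + 1)) := by positivity
  have hfrac' : 1 / (16 * (L₁ + 1)) ≤ 1 / 16 :=
    div_le_div_of_nonneg_left zero_le_one (by norm_num) (by linarith)
  have hs₀ : s₀ < 0 := by rw [hs₀def]; linarith
  have hs₀' : -1 + 1 / 2 < s₀ := by rw [hs₀def]; linarith
  refine ⟨s₀, hs₀, 0, ?_⟩
  -- the lower bound `3/4 ≤ ‖curl (V j s₀) 0‖`, eventually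
  have hev : ∀ᶠ j in atTop, A j < -1 := hA.eventually (eventually_lt_atBot _)
  have hlow : ∀ᶠ j in atTop, (3 : ℝ) / 4 ≤ ‖curl (V j s₀) 0‖ := by
    filter_upwards [hev] with j hj
    have hsub1 : Ioo (-1) 0 ⊆ Ioo (A j) (B j) := fun s hs => ⟨hj.trans hs.1, hs.2.trans (hB j)⟩
    have hVj := hCL (V j) ((hVsm j).continuousOn.mono (prod_mono hsub1 Subset.rfl))
      (fun s hs => hVdiv j s (hsub1 hs)) (fun s hs y => hVbd j s ⟨hj.trans hs.1, hs.2.le⟩ y)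
      (fun s s' hs hss' hs' y => hVmild j s s' (hj.trans hs) hss' hs' y)
    -- the uniform time-Lipschitz bound on `(−1/2, 0)`
    have hLip : ∀ t' ∈ Ioo s₀ 0, ‖fderiv ℝ (V j t') 0 - fderiv ℝ (V j s₀) 0‖ ≤ 1 / 16 := by
      intro t' ht'
      rw [norm_fderiv_sub_eq_norm_iteratedFDeriv_one_sub]
      have h1 := hVj.2.2.2 (1 / 2) (by norm_num) 1 s₀ ⟨hs₀', hs₀⟩ t' ⟨hs₀'.trans ht'.1, ht'.2⟩ 0
      have habs : |t' - s₀| ≤ 1 / (16 * (L₁ + 1)) := by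
        rw [abs_of_pos (sub_pos.2 ht'.1), hs₀def]; linarith [ht'.2]
      calc ‖iteratedFDeriv ℝ 1 (V j t') 0 - iteratedFDeriv ℝ 1 (V j s₀) 0‖
          ≤ L 1 (1 / 2) * |t' - s₀| := h1
        _ ≤ L₁ * |t' - s₀| := mul_le_mul_of_nonneg_right (le_max_left _ _) (abs_nonneg _)
        _ ≤ L₁ * (1 / (16 * (L₁ + 1))) := mul_le_mul_of_nonneg_left habs hL₁
        _ ≤ 1 / 16 := by
            rw [mul_one_div, div_le_div_iff₀ (by positivity) (by norm_num)]; nlinarith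
    -- pass to the final time `t' = 0` by continuity of `∇V j(·)(0)`
    have hcont : ContinuousOn (fun t' => fderiv ℝ (V j t') 0) (Ioo (A j) (B j)) :=
      stub_sliceFDerivContinuous (V j) (A j) (B j) (hVsm j) 0
    have hcat : ContinuousAt (fun t' => fderiv ℝ (V j t') 0) 0 :=
      hcont.continuousAt (isOpen_Ioo.mem_nhds ⟨hj.trans (by norm_num), hB j⟩)
    have htend : Tendsto (fun t' => ‖fderiv ℝ (V j t') 0 - fderiv ℝ (V j s₀) 0‖) (𝓝[<] 0)
        (𝓝 ‖fderiv ℝ (V j 0) 0 - fderiv ℝ (V j s₀) 0‖) :=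
      ((hcat.tendsto.sub_const _).norm).mono_left nhdsWithin_le_nhds
    have hev' : ∀ᶠ t' in 𝓝[<] (0 : ℝ), ‖fderiv ℝ (V j t') 0 - fderiv ℝ (V j s₀) 0‖ ≤ 1 / 16 := by
      rw [← nhdsWithin_Ioo_eq_nhdsLT hs₀]
      filter_upwards [self_mem_nhdsWithin] with t' ht' using hLip t' ht'
    have hle : ‖fderiv ℝ (V j 0) 0 - fderiv ℝ (V j s₀) 0‖ ≤ 1 / 16 := le_of_tendsto htend hev'
    -- the vorticity difference
    have hcd : ‖curl (V j 0) 0 - curl (V j s₀) 0‖ ≤ 1 / 4 := by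
      have e : curl (V j 0) 0 - curl (V j s₀) 0 =
          curlCLM (fderiv ℝ (V j 0) 0 - fderiv ℝ (V j s₀) 0) := by
        rw [map_sub]; rfl
      rw [e]
      calc ‖curlCLM (fderiv ℝ (V j 0) 0 - fderiv ℝ (V j s₀) 0)‖
          ≤ ‖curlCLM‖ * ‖fderiv ℝ (V j 0) 0 - fderiv ℝ (V j s₀) 0‖ := ContinuousLinearMap.le_opNorm _ _
        _ ≤ 4 * (1 / 16) := mul_le_mul norm_curlCLM_le_four hle (norm_nonneg _) (by norm_num)
        _ = 1 / 4 := by norm_num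
    have htri := norm_sub_norm_le (curl (V j 0) 0) (curl (V j s₀) 0)
    rw [hone j] at htri
    linarith
  -- pass to the limit `j → ∞`
  have hge : (3 : ℝ) / 4 ≤ ‖curl (W s₀) 0‖ := ge_of_tendsto (hcurl s₀ hs₀ 0).norm hlow
  intro h0
  rw [h0, norm_zero] at hge
  norm_num at hge


/-- **A record at the final time survives in the limit** (registered sub-goal `stub_zoomLimitRecord` of
the lead's `stub_zoomCoreUnit`; the `∀`-closed form of `zoomLimit_curl_ne_zero`). -/
theorem stub_zoomLimitRecord :
    ∀ (W : ℝ → EuclideanSpace ℝ (Fin 3) → EuclideanSpace ℝ (Fin 3)) (N : ℝ) (A B : ℕ → ℝ)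
      (V : ℕ → ℝ → EuclideanSpace ℝ (Fin 3) → EuclideanSpace ℝ (Fin 3)),
      Filter.Tendsto A Filter.atTop Filter.atBot → (∀ j, 0 < B j) →
      (∀ j, ContDiffOn ℝ (⊤ : ℕ∞) (Function.uncurry (V j)) (Set.Ioo (A j) (B j) ×ˢ Set.univ)) →
      (∀ j, ∀ t ∈ Set.Ioo (A j) (B j), Literature.Analysis.FluidPDE.IsWeaklyDivFree (V j t)) →
      (∀ j, ∀ t ∈ Set.Ioc (A j) 0, ∀ x, ‖V j t x‖ ≤ N) →
      (∀ j, ∀ s t : ℝ, A j < s → s < t → t < 0 → ∀ x,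
        V j t x = Literature.Analysis.UnboundedOperators.heatExtension (V j s) (t - s) x -
          Literature.Analysis.FluidPDE.oseenDuhamel 1 s (V j) (V j) t x) →
      (∀ j, ‖Literature.Analysis.FluidPDE.curl (V j 0) 0‖ = 1) →
      (∀ t < 0, ∀ x, Filter.Tendsto (fun j => Literature.Analysis.FluidPDE.curl (V j t) x) Filter.atTop
        (nhds (Literature.Analysis.FluidPDE.curl (W t) x))) →
      ∃ t < 0, ∃ x, Literature.Analysis.FluidPDE.curl (W t) x ≠ 0 :=
  fun _ _ _ _ _ hA hB hVsm hVdiv hVbd hVmild hone hcurl =>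
    zoomLimit_curl_ne_zero hA hB hVsm hVdiv hVbd hVmild hone hcurl

end Sequence

end Summit.NavierStokesRegularity.NavierStokesRegularity.Theorems.FluxZoom.Registered

end
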